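import Literature.MathematicalPhysics.QuantumManyBody.LiebSimpleEquationDecayErratum
import Mathlib
import HarnessLib

/-!
# «BIG-O BUDGET SHARPNESS» for crux ⟨stmt-QuantumFields-23035⟩ — reflection positivity of the witness, part 2: the Laplace–Fourier side

Free-hands work of width seat `ym-line-sfw-p2-w4` (g24, cell `ym-idea-1`) on the owner's NEGATIVE TARGET
`Cruxes/ShortRootRigidity/BigOBudgetSharpnessTarget.lean` (ym-idea-3 g21), clause `WitnessReflectionPositive`.  Def-free; imports the
tree's electrostatics (`LiebSimpleEquation.fourier_yukawa`, `LiebSimpleEquation.integrable_yukawa`) + Mathlib.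
* `iteratedDeriv_ofReal_comp` (`(d/ds)ⁿ` commutes with `ℝ ↪ ℂ`); `integrable_exp_neg_mul_norm_div_norm`,
  `integrable_norm_pow_mul_exp_neg_mul_norm` (`e^{−c|w|}/|w|`, `|w|ᵏe^{−c|w|} ∈ L¹(ℝ³)`);
* `hasDerivAt_integral_mul_cexp`, `iteratedDeriv_integral_mul_cexp` — `(d/ds)ⁿ ∫ b e^{sλ} = ∫ b λⁿ e^{sλ}` under domination on a ball;
* `integral_yukawa_mul_cexp` — BASE IDENTITY `∫_{ℝ³} e^{−2πτ|w|}|w|⁻¹ e^{−2πi⟪w,z⟫} dw = 1/(π(τ² + |z|²))` (`τ > 0`);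
* ★ `iteratedDeriv_six_inv_sq_eq_integral` — `(d/ds)⁶ [((t+sv₀)² + |z+sv⃗|²)⁻¹]₀ = π ∫ e^{−2πt|w|}|w|⁻¹e^{−2πi⟪w,z⟫}(−2πv₀|w| − 2πi⟪w,v⃗⟫)⁶ dw`
  (`t > 0`), with integrability of that integrand.
Part 1 (`…RPDeriv`: the same derivatives summed over the 24 roots give `−46080·K`) and the assembly are separate files.  HONEST LABEL:
sharpness bookkeeping about the HYPOTHESES of an OPEN crux; nothing of ⟨23035⟩, R2d or the YM mass gap is proved; `--supports 23035`.
-/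

set_option autoImplicit false

noncomputable section

namespace Summit.QuantumFields.YangMills.Cruxes.ShortRootRigidity.Sharpness

open MeasureTheory Set Filter Metric Complex
open scoped Topology RealInnerProductSpace FourierTransform BigOperators

/-! ## §0 Real functions viewed in `ℂ` -/
/-- `deriv` commutes with the embedding `ℝ ↪ ℂ` (at non-differentiable points both sides are `0`). [folklore] -/
theorem deriv_ofReal_comp (f : ℝ → ℝ) (x : ℝ) : deriv (fun s => (f s : ℂ)) x = ((deriv f x : ℝ) : ℂ) := by
  by_cases hf : DifferentiableAt ℝ f x
  · exact hf.hasDerivAt.ofReal_comp.deriv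
  · have hf' : ¬DifferentiableAt ℝ (fun s => (f s : ℂ)) x := by
      intro h; apply hf
      have h2 : DifferentiableAt ℝ (fun s => ((f s : ℂ)).re) x := Complex.reCLM.differentiableAt.comp x h
      simpa using h2
    rw [deriv_zero_of_not_differentiableAt hf, deriv_zero_of_not_differentiableAt hf', Complex.ofReal_zero]

/-- `iteratedDeriv` commutes with the embedding `ℝ ↪ ℂ`. [folklore] -/
theorem iteratedDeriv_ofReal_comp (f : ℝ → ℝ) (n : ℕ) :
    iteratedDeriv n (fun s => (f s : ℂ)) = fun x => ((iteratedDeriv n f x : ℝ) : ℂ) := by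
  induction n with
  | zero => simp
  | succ n ih =>
    rw [iteratedDeriv_succ, ih, iteratedDeriv_succ]
    funext x
    exact deriv_ofReal_comp _ x

/-! ## §1 Integrability on `ℝ³` -/
/-- Almost every point of `ℝ³` is non-zero. [folklore] -/
theorem ae_ne_zero_E3 : ∀ᵐ w : EuclideanSpace ℝ (Fin 3) ∂volume, w ≠ 0 := by
  have : (volume : Measure (EuclideanSpace ℝ (Fin 3))) {y | ¬y ≠ 0} = 0 := by
    simp only [ne_eq, not_not, setOf_eq_eq_singleton, measure_singleton]
  exact ae_iff.2 this

/-- `e^{−c|w|}/|w|` is integrable on `ℝ³` for `c > 0` (it is `4π · Y_{c²}`, the tree's Yukawa potential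
`LiebSimpleEquation.yukawa`, integrable by `LiebSimpleEquation.integrable_yukawa`). [folklore] -/
theorem integrable_exp_neg_mul_norm_div_norm {c : ℝ} (hc : 0 < c) :
    Integrable fun w : EuclideanSpace ℝ (Fin 3) => Real.exp (-(c * ‖w‖)) / ‖w‖ := by
  have hm : 0 < c ^ 2 := by positivity
  have h := (Literature.MathematicalPhysics.QuantumManyBody.LiebSimpleEquation.integrable_yukawa hm).const_mul (4 * Real.pi)
  refine h.congr (Eventually.of_forall fun w => ?_)
  simp only [Literature.MathematicalPhysics.QuantumManyBody.LiebSimpleEquation.yukawa]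
  rw [Real.sqrt_sq hc.le]
  by_cases hw : ‖w‖ = 0
  · rw [hw]; simp
  · have hπ : (Real.pi : ℝ) ≠ 0 := Real.pi_pos.ne'
    field_simp

/-- `uᵏ e^{−au} ≤ k!/aᵏ` for `u ≥ 0`, `a > 0`. [folklore] -/
theorem pow_mul_exp_neg_mul_le (k : ℕ) {a : ℝ} (ha : 0 < a) {u : ℝ} (hu : 0 ≤ u) :
    u ^ k * Real.exp (-(a * u)) ≤ k.factorial / a ^ k := by
  have h := Real.pow_div_factorial_le_exp (a * u) (mul_nonneg ha.le hu) k
  have hk : (0 : ℝ) < k.factorial := by exact_mod_cast Nat.factorial_pos k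
  have hak : 0 < a ^ k := pow_pos ha k
  rw [div_le_iff₀ hk] at h
  rw [le_div_iff₀ hak, Real.exp_neg]
  have hexp : 0 < Real.exp (a * u) := Real.exp_pos _
  rw [mul_pow] at h
  calc u ^ k * (Real.exp (a * u))⁻¹ * a ^ k = (a ^ k * u ^ k) / Real.exp (a * u) := by
        rw [div_eq_mul_inv]; ring
    _ ≤ ↑k.factorial := by rw [div_le_iff₀ hexp]; linarith

/-- `|w|ᵏ e^{−c|w|}` is integrable on `ℝ³` for `c > 0` (dominated by `(k+1)!/(c/2)ᵏ⁺¹ · e^{−c|w|/2}/|w|`). [folklore] -/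
theorem integrable_norm_pow_mul_exp_neg_mul_norm (k : ℕ) {c : ℝ} (hc : 0 < c) :
    Integrable fun w : EuclideanSpace ℝ (Fin 3) => ‖w‖ ^ k * Real.exp (-(c * ‖w‖)) := by
  have hc2 : 0 < c / 2 := half_pos hc
  set M : ℝ := (k + 1).factorial / (c / 2) ^ (k + 1) with hM
  refine Integrable.mono' ((integrable_exp_neg_mul_norm_div_norm hc2).const_mul M) ?_ ?_
  · exact ((continuous_norm.pow k).mul (Real.continuous_exp.comp (continuous_const.mul continuous_norm).neg)).aestronglyMeasurable
  · filter_upwards [ae_ne_zero_E3] with w hw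
    have hn : 0 < ‖w‖ := norm_pos_iff.2 hw
    have hkey := pow_mul_exp_neg_mul_le (k + 1) hc2 hn.le
    rw [Real.norm_of_nonneg (by positivity)]
    have hsplit : ‖w‖ ^ k * Real.exp (-(c * ‖w‖)) =
        (‖w‖ ^ (k + 1) * Real.exp (-(c / 2 * ‖w‖))) * (Real.exp (-(c / 2 * ‖w‖)) / ‖w‖) := by
      rw [show -(c * ‖w‖) = -(c / 2 * ‖w‖) + -(c / 2 * ‖w‖) by ring, Real.exp_add]
      field_simp
      ring
    rw [hsplit]
    exact mul_le_mul_of_nonneg_right hkey (by positivity)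

/-! ## §2 Differentiation of `s ↦ ∫ b e^{sλ}` under the integral sign -/
section Parametric
variable {X : Type*} [MeasurableSpace X] {μ : Measure X} {b lam : X → ℂ}
/-- One derivative under the integral sign for `s ↦ ∫ b(x) e^{s λ(x)} dμ` (real parameter `s`), given a dominating function for
`b λ e^{sλ}` on a ball. [folklore] -/
theorem hasDerivAt_integral_mul_cexp (hb : AEStronglyMeasurable b μ) (hlam : AEStronglyMeasurable lam μ) {s₀ ε : ℝ}
    (hε : 0 < ε) (hint : Integrable (fun x => b x * cexp (↑s₀ * lam x)) μ) {bound : X → ℝ}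
    (hbound : Integrable bound μ) (hdom : ∀ᵐ x ∂μ, ∀ s ∈ ball s₀ ε, ‖b x * lam x * cexp (↑s * lam x)‖ ≤ bound x) :
    Integrable (fun x => b x * lam x * cexp (↑s₀ * lam x)) μ ∧
      HasDerivAt (fun s : ℝ => ∫ x, b x * cexp (↑s * lam x) ∂μ) (∫ x, b x * lam x * cexp (↑s₀ * lam x) ∂μ) s₀ := by
  have hFm : ∀ s : ℝ, AEStronglyMeasurable (fun x => b x * cexp (↑s * lam x)) μ := fun s =>
    hb.mul (Complex.continuous_exp.comp_aestronglyMeasurable (hlam.const_mul _))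
  have hF'm : AEStronglyMeasurable (fun x => b x * lam x * cexp (↑s₀ * lam x)) μ :=
    (hb.mul hlam).mul (Complex.continuous_exp.comp_aestronglyMeasurable (hlam.const_mul _))
  refine hasDerivAt_integral_of_dominated_loc_of_deriv_le (𝕜 := ℝ) (x₀ := s₀)
    (F := fun (s : ℝ) x => b x * cexp ((s : ℂ) * lam x))
    (F' := fun (s : ℝ) x => b x * lam x * cexp ((s : ℂ) * lam x)) (ball_mem_nhds s₀ hε) (Eventually.of_forall hFm) hint
    hF'm hdom hbound (Eventually.of_forall fun x s _ => ?_)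
  have h1 : HasDerivAt (fun w : ℂ => w * lam x) (lam x) (s : ℂ) := by
    simpa using (hasDerivAt_id (s : ℂ)).mul_const (lam x)
  have h2 : HasDerivAt (fun y : ℝ => cexp (↑y * lam x)) (cexp (↑s * lam x) * lam x) s := h1.cexp.comp_ofReal
  exact (h2.const_mul (b x)).congr_deriv (by ring)

/-- **`n` derivatives under the integral sign**: on a ball around `0` where every `b λᵏ⁺¹ e^{sλ}` is dominated,
`(d/ds)ⁿ ∫ b e^{sλ} = ∫ b λⁿ e^{sλ}` (and the latter integrand is integrable). [folklore] -/
theorem iteratedDeriv_integral_mul_cexp (hb : AEStronglyMeasurable b μ) (hlam : AEStronglyMeasurable lam μ) {ρ : ℝ}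
    (hint : ∀ s ∈ ball (0 : ℝ) ρ, Integrable (fun x => b x * cexp (↑s * lam x)) μ) (bound : ℕ → X → ℝ)
    (hbound : ∀ k, Integrable (bound k) μ)
    (hdom : ∀ k, ∀ᵐ x ∂μ, ∀ s ∈ ball (0 : ℝ) ρ, ‖b x * lam x ^ (k + 1) * cexp (↑s * lam x)‖ ≤ bound k x) (n : ℕ) :
    ∀ s ∈ ball (0 : ℝ) ρ, Integrable (fun x => b x * lam x ^ n * cexp (↑s * lam x)) μ ∧
      iteratedDeriv n (fun s : ℝ => ∫ x, b x * cexp (↑s * lam x) ∂μ) s = ∫ x, b x * lam x ^ n * cexp (↑s * lam x) ∂μ := by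
  induction n with
  | zero =>
    intro s hs
    simpa using hint s hs
  | succ k ih =>
    intro s hs
    have hs' : |s| < ρ := by simpa [Real.dist_eq] using hs
    have hε : 0 < ρ - |s| := sub_pos.2 hs'
    have hsub : ball s (ρ - |s|) ⊆ ball (0 : ℝ) ρ := by
      intro s' hs''
      rw [mem_ball, Real.dist_eq] at hs'' ⊢
      rw [sub_zero]
      have := abs_sub_abs_le_abs_sub s' s
      linarith
    have hb' : AEStronglyMeasurable (fun x => b x * lam x ^ k) μ := hb.mul (hlam.pow k)
    have hdom' : ∀ᵐ x ∂μ, ∀ s' ∈ ball s (ρ - |s|), ‖b x * lam x ^ k * lam x * cexp (↑s' * lam x)‖ ≤ bound k x := by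
      filter_upwards [hdom k] with x hx s' hs''
      have h := hx s' (hsub hs'')
      rwa [pow_succ, ← mul_assoc] at h
    obtain ⟨hI, hD⟩ := hasDerivAt_integral_mul_cexp hb' hlam hε (ih s hs).1 (hbound k) hdom'
    refine ⟨hI.congr (Eventually.of_forall fun x => by simp only [pow_succ]; ring), ?_⟩
    rw [iteratedDeriv_succ]
    have hev : iteratedDeriv k (fun s : ℝ => ∫ x, b x * cexp (↑s * lam x) ∂μ) =ᶠ[𝓝 s]
        fun s => ∫ x, b x * lam x ^ k * cexp (↑s * lam x) ∂μ := by
      filter_upwards [isOpen_ball.mem_nhds hs] with s' hs'' using (ih s' hs'').2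
    rw [hev.deriv_eq, hD.deriv]
    exact integral_congr_ae (Eventually.of_forall fun x => by simp only [pow_succ]; ring)
end Parametric

/-! ## §3 The base identity: `1/(τ² + |z|²)` as a Yukawa–Fourier integral over `ℝ³` -/
/-- **Base identity** (from the tree's `LiebSimpleEquation.fourier_yukawa`, the Fourier transform of the Yukawa potential
`e^{−√μ|x|}/(4π|x|)` on `ℝ³`): for `τ > 0` and `z ∈ ℝ³`, `∫ e^{−2πτ|w|}|w|⁻¹ e^{−2πi⟪w,z⟫} dw = (π(τ² + |z|²))⁻¹`. [folklore] -/
theorem integral_yukawa_mul_cexp {τ : ℝ} (hτ : 0 < τ) (z : EuclideanSpace ℝ (Fin 3)) :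
    ∫ (w : EuclideanSpace ℝ (Fin 3)), ((Real.exp (-(2 * Real.pi * τ * ‖w‖)) / ‖w‖ : ℝ) : ℂ) *
        cexp (↑(-2 * Real.pi * ⟪w, z⟫) * I) = (((Real.pi * (τ ^ 2 + ‖z‖ ^ 2))⁻¹ : ℝ) : ℂ) := by
  have hμ : 0 < (2 * Real.pi * τ) ^ 2 := by positivity
  have h := Literature.MathematicalPhysics.QuantumManyBody.LiebSimpleEquation.fourier_yukawa hμ z
  rw [Real.fourier_eq'] at h
  simp only [Literature.MathematicalPhysics.QuantumManyBody.LiebSimpleEquation.yukawa, smul_eq_mul] at h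
  rw [Real.sqrt_sq (by positivity)] at h
  have hπ0 : (Real.pi : ℝ) ≠ 0 := Real.pi_pos.ne'
  have e : ∀ w : EuclideanSpace ℝ (Fin 3),
      ((Real.exp (-(2 * Real.pi * τ * ‖w‖)) / ‖w‖ : ℝ) : ℂ) * cexp (↑(-2 * Real.pi * ⟪w, z⟫) * I) =
      ((4 * Real.pi : ℝ) : ℂ) * (cexp (↑(-2 * Real.pi * ⟪w, z⟫) * I) *
        ((Real.exp (-(2 * Real.pi * τ * ‖w‖)) / (4 * Real.pi * ‖w‖) : ℝ) : ℂ)) := by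
    intro w
    by_cases hw : ‖w‖ = 0
    · rw [hw]; simp
    · have hw' : (‖w‖ : ℂ) ≠ 0 := by exact_mod_cast hw
      have hπ' : (Real.pi : ℂ) ≠ 0 := by exact_mod_cast hπ0
      push_cast
      field_simp
  simp_rw [e]
  rw [integral_const_mul, h]
  push_cast
  have hπ : (Real.pi : ℂ) ≠ 0 := by exact_mod_cast hπ0
  have hden : ((τ : ℂ) ^ 2 + (‖z‖ : ℂ) ^ 2) ≠ 0 := by
    norm_cast
    positivity
  field_simp
  ring

/-! ## §4 The Laplace–Fourier integrand of `‖x + sv‖⁻²` and its domination -/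
/-- Bookkeeping of exponentials: `e^{a₁} r e^{a₂} = e^{b₁} r e^{b₂} e^{b₃}` when `a₁ + a₂ = b₁ + b₂ + b₃`. [folklore] -/
theorem cexp_mul_inv_mul_cexp_eq (a₁ a₂ b₁ b₂ b₃ r : ℂ) (h : a₁ + a₂ = b₁ + b₂ + b₃) :
    cexp a₁ * r * cexp a₂ = cexp b₁ * r * cexp b₂ * cexp b₃ := by
  rw [show cexp b₁ * r * cexp b₂ * cexp b₃ = r * (cexp b₁ * cexp b₂ * cexp b₃) by ring, ← Complex.exp_add,
    ← Complex.exp_add, ← h, Complex.exp_add]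
  ring


section LF
variable (t : ℝ) (z : EuclideanSpace ℝ (Fin 3)) (v₀ : ℝ) (v : EuclideanSpace ℝ (Fin 3))
/-- Norm of the static factor `e^{−2πt|w|}|w|⁻¹ e^{−2πi⟪w,z⟫}`. [folklore] -/
theorem norm_yukawaPhase (w : EuclideanSpace ℝ (Fin 3)) :
    ‖((Real.exp (-(2 * Real.pi * t * ‖w‖)) / ‖w‖ : ℝ) : ℂ) * cexp (↑(-2 * Real.pi * ⟪w, z⟫) * I)‖ =
      Real.exp (-(2 * Real.pi * t * ‖w‖)) / ‖w‖ := by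
  rw [norm_mul, Complex.norm_exp_ofReal_mul_I, mul_one, Complex.norm_real, Real.norm_of_nonneg (by positivity)]

/-- Norm of the exponent slope `λ_v(w) = −2πv₀|w| − 2πi⟪w,v⃗⟫`: `|λ_v(w)| ≤ 2π(|v₀| + |v⃗|)|w|`. [folklore] -/
theorem norm_slope_le (w : EuclideanSpace ℝ (Fin 3)) :
    ‖((-(2 * Real.pi * v₀ * ‖w‖) : ℝ) : ℂ) + ((-(2 * Real.pi * ⟪w, v⟫) : ℝ) : ℂ) * I‖ ≤
      2 * Real.pi * (|v₀| + ‖v‖) * ‖w‖ := by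
  refine (norm_add_le _ _).trans ?_
  rw [norm_mul, Complex.norm_I, mul_one, Complex.norm_real, Complex.norm_real, Real.norm_eq_abs, Real.norm_eq_abs]
  simp only [abs_mul, abs_neg, abs_two, abs_of_pos Real.pi_pos, abs_norm]
  have h1 : |⟪w, v⟫| ≤ ‖w‖ * ‖v‖ := abs_real_inner_le_norm w v
  have h2 : 0 ≤ 2 * Real.pi := Real.two_pi_pos.le
  nlinarith [abs_nonneg v₀, norm_nonneg w, norm_nonneg v, mul_nonneg h2 (norm_nonneg w), Real.pi_pos]

/-- Norm of `e^{s λ_v(w)}`: `e^{−2π s v₀ |w|}`. [folklore] -/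
theorem norm_cexp_slope (s : ℝ) (w : EuclideanSpace ℝ (Fin 3)) :
    ‖cexp (↑s * (((-(2 * Real.pi * v₀ * ‖w‖) : ℝ) : ℂ) + ((-(2 * Real.pi * ⟪w, v⟫) : ℝ) : ℂ) * I))‖ =
      Real.exp (-(2 * Real.pi * v₀ * ‖w‖) * s) := by
  rw [Complex.norm_exp]
  congr 1
  simp [Complex.mul_re]
  ring

variable {t}
/-- On the ball `|s| < t/(2(|v₀|+1))` the time component stays positive: `|v₀ s| ≤ t/2`. [folklore] -/
theorem abs_mul_le_half (ht : 0 < t) {s : ℝ} (hs : s ∈ ball (0 : ℝ) (t / (2 * (|v₀| + 1)))) : |v₀| * |s| ≤ t / 2 := by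
  rw [mem_ball, Real.dist_eq, sub_zero] at hs
  have h1 : 0 < |v₀| + 1 := by positivity
  have h2 : |v₀| * |s| ≤ (|v₀| + 1) * |s| := by nlinarith [abs_nonneg s, abs_nonneg v₀]
  have h3 : (|v₀| + 1) * |s| ≤ (|v₀| + 1) * (t / (2 * (|v₀| + 1))) := mul_le_mul_of_nonneg_left hs.le h1.le
  have h4 : (|v₀| + 1) * (t / (2 * (|v₀| + 1))) = t / 2 := by field_simp
  linarith

/-- **Domination** of the differentiated integrands on the ball `|s| < t/(2(|v₀|+1))`:
`‖b λᵏ⁺¹ e^{sλ}‖ ≤ (2π(|v₀|+|v⃗|))ᵏ⁺¹ |w|ᵏ e^{−πt|w|}`. [folklore] -/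
theorem norm_integrand_le (ht : 0 < t) (k : ℕ) (w : EuclideanSpace ℝ (Fin 3)) {s : ℝ}
    (hs : s ∈ ball (0 : ℝ) (t / (2 * (|v₀| + 1)))) :
    ‖((Real.exp (-(2 * Real.pi * t * ‖w‖)) / ‖w‖ : ℝ) : ℂ) * cexp (↑(-2 * Real.pi * ⟪w, z⟫) * I) *
        (((-(2 * Real.pi * v₀ * ‖w‖) : ℝ) : ℂ) + ((-(2 * Real.pi * ⟪w, v⟫) : ℝ) : ℂ) * I) ^ (k + 1) *
        cexp (↑s * (((-(2 * Real.pi * v₀ * ‖w‖) : ℝ) : ℂ) + ((-(2 * Real.pi * ⟪w, v⟫) : ℝ) : ℂ) * I))‖ ≤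
      (2 * Real.pi * (|v₀| + ‖v‖)) ^ (k + 1) * ‖w‖ ^ k * Real.exp (-(Real.pi * t * ‖w‖)) := by
  by_cases hw : w = 0
  · subst hw
    simp
    positivity
  have hn : 0 < ‖w‖ := norm_pos_iff.2 hw
  have hvs := abs_mul_le_half v₀ ht hs
  rw [norm_mul, norm_mul, norm_pow, norm_yukawaPhase, norm_cexp_slope]
  have hL := norm_slope_le v₀ v w
  set L : ℝ := 2 * Real.pi * (|v₀| + ‖v‖) with hL'
  have hL0 : 0 ≤ L := by positivity
  have hpow : ‖((-(2 * Real.pi * v₀ * ‖w‖) : ℝ) : ℂ) + ((-(2 * Real.pi * ⟪w, v⟫) : ℝ) : ℂ) * I‖ ^ (k + 1) ≤ (L * ‖w‖) ^ (k + 1) :=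
    pow_le_pow_left₀ (norm_nonneg _) hL (k + 1)
  have hexp : Real.exp (-(2 * Real.pi * t * ‖w‖)) * Real.exp (-(2 * Real.pi * v₀ * ‖w‖) * s) ≤
      Real.exp (-(Real.pi * t * ‖w‖)) := by
    rw [← Real.exp_add]
    refine Real.exp_le_exp.2 ?_
    have h1 : -(2 * Real.pi * v₀ * ‖w‖) * s ≤ 2 * Real.pi * ‖w‖ * (|v₀| * |s|) := by
      have : -(2 * Real.pi * v₀ * ‖w‖) * s ≤ |-(2 * Real.pi * v₀ * ‖w‖) * s| := le_abs_self _
      simp only [abs_mul, abs_neg, abs_two, abs_of_pos Real.pi_pos, abs_norm] at this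
      nlinarith [Real.pi_pos, abs_nonneg v₀, abs_nonneg s, hn]
    have h2 : 2 * Real.pi * ‖w‖ * (|v₀| * |s|) ≤ 2 * Real.pi * ‖w‖ * (t / 2) :=
      mul_le_mul_of_nonneg_left hvs (by positivity)
    nlinarith [Real.pi_pos]
  calc Real.exp (-(2 * Real.pi * t * ‖w‖)) / ‖w‖ *
        ‖((-(2 * Real.pi * v₀ * ‖w‖) : ℝ) : ℂ) + ((-(2 * Real.pi * ⟪w, v⟫) : ℝ) : ℂ) * I‖ ^ (k + 1) *
        Real.exp (-(2 * Real.pi * v₀ * ‖w‖) * s)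
      ≤ Real.exp (-(2 * Real.pi * t * ‖w‖)) / ‖w‖ * (L * ‖w‖) ^ (k + 1) * Real.exp (-(2 * Real.pi * v₀ * ‖w‖) * s) := by
        gcongr
    _ = (L ^ (k + 1) * ‖w‖ ^ k) * (Real.exp (-(2 * Real.pi * t * ‖w‖)) * Real.exp (-(2 * Real.pi * v₀ * ‖w‖) * s)) := by
        rw [mul_pow, pow_succ]
        field_simp
        ring
    _ ≤ (L ^ (k + 1) * ‖w‖ ^ k) * Real.exp (-(Real.pi * t * ‖w‖)) :=
        mul_le_mul_of_nonneg_left hexp (by positivity)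
    _ = L ^ (k + 1) * ‖w‖ ^ k * Real.exp (-(Real.pi * t * ‖w‖)) := by ring

/-- Integrability of the undifferentiated integrand on the ball (dominated by `e^{−πt|w|}/|w|`). [folklore] -/
theorem integrable_integrand (ht : 0 < t) {s : ℝ} (hs : s ∈ ball (0 : ℝ) (t / (2 * (|v₀| + 1)))) :
    Integrable fun w : EuclideanSpace ℝ (Fin 3) =>
      ((Real.exp (-(2 * Real.pi * t * ‖w‖)) / ‖w‖ : ℝ) : ℂ) * cexp (↑(-2 * Real.pi * ⟪w, z⟫) * I) *
        cexp (↑s * (((-(2 * Real.pi * v₀ * ‖w‖) : ℝ) : ℂ) + ((-(2 * Real.pi * ⟪w, v⟫) : ℝ) : ℂ) * I)) := by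
  have hvs := abs_mul_le_half v₀ ht hs
  refine Integrable.mono' (integrable_exp_neg_mul_norm_div_norm (c := Real.pi * t) (by positivity)) ?_ ?_
  · refine (AEStronglyMeasurable.mul ?_ ?_).mul ?_
    · exact (Complex.measurable_ofReal.comp ((Real.measurable_exp.comp
        ((measurable_const.mul measurable_norm).neg)).div measurable_norm)).aestronglyMeasurable
    · exact (Complex.continuous_exp.comp ((Complex.continuous_ofReal.comp
        (continuous_const.mul (continuous_id.inner continuous_const))).mul continuous_const)).aestronglyMeasurable
    · exact (Complex.continuous_exp.comp (continuous_const.mul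
        ((Complex.continuous_ofReal.comp (continuous_const.mul continuous_norm).neg).add
          ((Complex.continuous_ofReal.comp (continuous_const.mul (continuous_id.inner continuous_const)).neg).mul
            continuous_const)))).aestronglyMeasurable
  · filter_upwards [ae_ne_zero_E3] with w hw
    have hn : 0 < ‖w‖ := norm_pos_iff.2 hw
    rw [norm_mul, norm_yukawaPhase, norm_cexp_slope, div_mul_eq_mul_div, div_le_div_iff_of_pos_right hn, ← Real.exp_add]
    refine Real.exp_le_exp.2 ?_
    have h1 : -(2 * Real.pi * v₀ * ‖w‖) * s ≤ 2 * Real.pi * ‖w‖ * (|v₀| * |s|) := by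
      have : -(2 * Real.pi * v₀ * ‖w‖) * s ≤ |-(2 * Real.pi * v₀ * ‖w‖) * s| := le_abs_self _
      simp only [abs_mul, abs_neg, abs_two, abs_of_pos Real.pi_pos, abs_norm] at this
      nlinarith [Real.pi_pos, abs_nonneg v₀, abs_nonneg s, hn]
    have h2 : 2 * Real.pi * ‖w‖ * (|v₀| * |s|) ≤ 2 * Real.pi * ‖w‖ * (t / 2) :=
      mul_le_mul_of_nonneg_left hvs (by positivity)
    nlinarith [Real.pi_pos]

/-- ★ **The Laplace–Fourier form of `(d/ds)⁶ ‖x + sv‖⁻²`**: for `t > 0`, `z, v⃗ ∈ ℝ³`, `v₀ ∈ ℝ`,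
`(d/ds)⁶ [((t+sv₀)² + |z+sv⃗|²)⁻¹]₀ = π ∫ e^{−2πt|w|}|w|⁻¹e^{−2πi⟪w,z⟫} (−2πv₀|w| − 2πi⟪w,v⃗⟫)⁶ dw`,
and the integrand is integrable. [folklore] -/
theorem iteratedDeriv_six_inv_sq_eq_integral (ht : 0 < t) :
    Integrable (fun w : EuclideanSpace ℝ (Fin 3) =>
      ((Real.exp (-(2 * Real.pi * t * ‖w‖)) / ‖w‖ : ℝ) : ℂ) * cexp (↑(-2 * Real.pi * ⟪w, z⟫) * I) *
        (((-(2 * Real.pi * v₀ * ‖w‖) : ℝ) : ℂ) + ((-(2 * Real.pi * ⟪w, v⟫) : ℝ) : ℂ) * I) ^ 6) ∧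
    ((iteratedDeriv 6 (fun s : ℝ => ((t + s * v₀) ^ 2 + ‖z + s • v‖ ^ 2)⁻¹) 0 : ℝ) : ℂ) =
      ↑Real.pi * ∫ (w : EuclideanSpace ℝ (Fin 3)),
        ((Real.exp (-(2 * Real.pi * t * ‖w‖)) / ‖w‖ : ℝ) : ℂ) * cexp (↑(-2 * Real.pi * ⟪w, z⟫) * I) *
          (((-(2 * Real.pi * v₀ * ‖w‖) : ℝ) : ℂ) + ((-(2 * Real.pi * ⟪w, v⟫) : ℝ) : ℂ) * I) ^ 6 := by
  set ρ : ℝ := t / (2 * (|v₀| + 1)) with hρ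
  have hρ0 : 0 < ρ := by positivity
  have hb : AEStronglyMeasurable (fun w : EuclideanSpace ℝ (Fin 3) =>
      ((Real.exp (-(2 * Real.pi * t * ‖w‖)) / ‖w‖ : ℝ) : ℂ) * cexp (↑(-2 * Real.pi * ⟪w, z⟫) * I)) volume := by
    refine AEStronglyMeasurable.mul ?_ ?_
    · exact (Complex.measurable_ofReal.comp ((Real.measurable_exp.comp
        ((measurable_const.mul measurable_norm).neg)).div measurable_norm)).aestronglyMeasurable
    · exact (Complex.continuous_exp.comp ((Complex.continuous_ofReal.comp
        (continuous_const.mul (continuous_id.inner continuous_const))).mul continuous_const)).aestronglyMeasurable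
  have hlam : AEStronglyMeasurable (fun w : EuclideanSpace ℝ (Fin 3) =>
      ((-(2 * Real.pi * v₀ * ‖w‖) : ℝ) : ℂ) + ((-(2 * Real.pi * ⟪w, v⟫) : ℝ) : ℂ) * I) volume :=
    (((Complex.continuous_ofReal.comp (continuous_const.mul continuous_norm).neg).add
      ((Complex.continuous_ofReal.comp (continuous_const.mul (continuous_id.inner continuous_const)).neg).mul
        continuous_const))).aestronglyMeasurable
  have hbd : ∀ k : ℕ, Integrable (fun w : EuclideanSpace ℝ (Fin 3) =>
      (2 * Real.pi * (|v₀| + ‖v‖)) ^ (k + 1) * ‖w‖ ^ k * Real.exp (-(Real.pi * t * ‖w‖))) := fun k =>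
    ((integrable_norm_pow_mul_exp_neg_mul_norm k (show 0 < Real.pi * t by positivity)).const_mul
      ((2 * Real.pi * (|v₀| + ‖v‖)) ^ (k + 1))).congr (Eventually.of_forall fun w => by ring)
  have hiter := iteratedDeriv_integral_mul_cexp (μ := volume) hb hlam (ρ := ρ)
    (fun s hs => integrable_integrand z v₀ v ht hs)
    (fun k w => (2 * Real.pi * (|v₀| + ‖v‖)) ^ (k + 1) * ‖w‖ ^ k * Real.exp (-(Real.pi * t * ‖w‖))) hbd
    (fun k => Eventually.of_forall fun w s hs => norm_integrand_le z v₀ v ht k w hs) 6 0 (mem_ball_self hρ0)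
  obtain ⟨hI, hD⟩ := hiter
  simp only [Complex.ofReal_zero, zero_mul, Complex.exp_zero, mul_one] at hI hD
  refine ⟨hI, ?_⟩
  have hev : (fun s : ℝ => ((((t + s * v₀) ^ 2 + ‖z + s • v‖ ^ 2)⁻¹ : ℝ) : ℂ)) =ᶠ[𝓝 0]
      fun s => ↑Real.pi * ∫ (w : EuclideanSpace ℝ (Fin 3)),
        ((Real.exp (-(2 * Real.pi * t * ‖w‖)) / ‖w‖ : ℝ) : ℂ) * cexp (↑(-2 * Real.pi * ⟪w, z⟫) * I) *
          cexp (↑s * (((-(2 * Real.pi * v₀ * ‖w‖) : ℝ) : ℂ) + ((-(2 * Real.pi * ⟪w, v⟫) : ℝ) : ℂ) * I)) := by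
    filter_upwards [isOpen_ball.mem_nhds (mem_ball_self hρ0)] with s hs
    have hvs := abs_mul_le_half v₀ ht hs
    have hτ : 0 < t + s * v₀ := by
      have : -(t / 2) ≤ s * v₀ := by
        have h := neg_abs_le (s * v₀)
        rw [abs_mul, mul_comm] at h
        linarith
      linarith
    have hbase := integral_yukawa_mul_cexp hτ (z + s • v)
    have e : ∀ w : EuclideanSpace ℝ (Fin 3),
        ((Real.exp (-(2 * Real.pi * (t + s * v₀) * ‖w‖)) / ‖w‖ : ℝ) : ℂ) * cexp (↑(-2 * Real.pi * ⟪w, z + s • v⟫) * I) =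
        ((Real.exp (-(2 * Real.pi * t * ‖w‖)) / ‖w‖ : ℝ) : ℂ) * cexp (↑(-2 * Real.pi * ⟪w, z⟫) * I) *
          cexp (↑s * (((-(2 * Real.pi * v₀ * ‖w‖) : ℝ) : ℂ) + ((-(2 * Real.pi * ⟪w, v⟫) : ℝ) : ℂ) * I)) := by
      intro w
      rw [inner_add_right, real_inner_smul_right]
      simp only [Complex.ofReal_div, Complex.ofReal_exp]
      simp only [div_eq_mul_inv]
      refine cexp_mul_inv_mul_cexp_eq _ _ _ _ _ _ ?_
      push_cast
      ring
    simp_rw [e] at hbase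
    rw [hbase]
    push_cast
    have hπ : (Real.pi : ℂ) ≠ 0 := by exact_mod_cast Real.pi_pos.ne'
    have hden : (((t : ℂ) + (s : ℂ) * (v₀ : ℂ)) ^ 2 + (‖z + s • v‖ : ℂ) ^ 2) ≠ 0 := by
      norm_cast
      positivity
    field_simp
  have h6 := hev.iteratedDeriv_eq 6
  rw [iteratedDeriv_ofReal_comp] at h6
  simp only at h6
  rw [h6, iteratedDeriv_const_mul_field, hD]
end LF

end Summit.QuantumFields.YangMills.Cruxes.ShortRootRigidity.Sharpness

end
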